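import Mathlib
import Literature.Barriers.ValiantsHypothesis.MonotoneGapPermanentLower
import Literature.Computability.AlgebraicComplexity.PermanentIrreducible

/-!
# `DivisionGap.PerMultiplesHard` (stmt-ValiantsHypothesis-5068), line `typed-parse-tree-weights`:
Jerrum–Snir's permanent weights as a path certificate on every face (stub `stub_faceCertificate`)

For every set of cells `G ⊆ [n]²` the face permanent `F_G = Σ_{π ⊆ G} Π_i X_{π i, i}` (sum over the
permutations all of whose cells `(π i, i)` lie in `G`) carries a *path certificate* `(τg, p, φ)` in
the sense of the line's engine `stub_pathWeightBound`:

* `τg = (𝟙, 𝟙)` — every monomial of `F_G` is a permutation monomial `μ_π`, whose torus type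
  (row margins, column margins) `= (mapDomain fst μ_π, mapDomain snd μ_π)` is the all-ones pair;
* `p ≡ 1` (the uniform test measure);
* `φ(τ) = w(|τ.1|) / (n² + 1)` with Jerrum–Snir's weight function `w = JerrumSnir.perWeight n`
  (`MonotoneGapPermanentWeights.lean`), `|τ.1| = Finsupp.degree τ.1` the total row margin.

The checks: `φ` vanishes on the unit and on single variables (`w(0) = w(1) = 0`); the jump
constraint `(φ(τ₁+τ₂) - max(φ τ₁, φ τ₂)) · |A|·|B|·|C| ≤ 1` for `A + B + C ⊆ supp F_G ⊆ supp per_n`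
follows from the permanent's content bound `|A|·|B|·|C| ≤ δ(r, d) = d! (r-d)! (n-r)!`
(`JerrumSnir.card_mul_card_mul_card_le`), the recurrence `w(r) ≤ w(d) + w(r-d) + 1/δ(r,d)`
(`JerrumSnir.perWeight_rec`), monotonicity of `w`, and the new estimate
`w(d) · δ(r, d) ≤ n²` for `2d ≤ r ≤ n` (`perWeight_mul_perDelta_le`, from
`w(d) · d! · (n-d)! ≤ d²` for `2d ≤ n + 1`, proved by induction on `d` with `perWeight_succ`);
the value is `|PM(G)| · w(n) / (n²+1)` with `n! · w(n) = n (2^{n-1} - 1)`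
(`JerrumSnir.factorial_mul_perWeight`), i.e. the last conjunct holds with equality.

Log (stub-worker): the support of `F_G` is computed as in the sibling stub file
`DivisionGapPerMultiplesHardStubRichFaces.lean` (`support_sum_monomial_permMonomial`, adapted to the
product-of-variables form `Π_i X_{π i, i} = monomial μ_π 1`); everything is stated for an arbitrary
finite set `S` of permutations (`faceCertificate`) and specialised to `S = PM(G)` at the end.
[cite: JerrumSnir1982, §4.3]
-/

noncomputable section

-- D-0017: single-problem summit, so the namespace `Summit.ValiantsHypothesis.ValiantsHypothesis.…`
-- repeats a component by design (the Summits library sets this option in the lakefile).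
set_option linter.dupNamespace false

open MvPolynomial Literature.Computability.AlgebraicComplexity
open scoped NNReal BigOperators
open Literature.Barriers.ValiantsHypothesis Literature.Barriers.ValiantsHypothesis.JerrumSnir

namespace Summit.ValiantsHypothesis.ValiantsHypothesis.Theorems.DivisionGap.PerMultiplesHard.FaceCertificate

variable {n : ℕ}

/-! ### The face polynomial of a set of permutations and its support -/

/-- `Π_i X_{π i, i} = x^{μ_π}` (the permutation monomial with coefficient `1`). [folklore] -/
theorem prod_X_eq_monomial (π : Equiv.Perm (Fin n)) :
    ∏ i : Fin n, (X (π i, i) : MvPolynomial (Fin n × Fin n) ℝ≥0) = monomial (permMonomial π) 1 := by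
  rw [permMonomial, monomial_sum_one]
  rfl

/-- `Σ_{π ∈ S} Π_i X_{π i, i} = Σ_{π ∈ S} x^{μ_π}`. [folklore] -/
theorem sum_prod_X_eq (S : Finset (Equiv.Perm (Fin n))) :
    ∑ π ∈ S, ∏ i : Fin n, (X (π i, i) : MvPolynomial (Fin n × Fin n) ℝ≥0) =
      ∑ π ∈ S, monomial (permMonomial π) 1 :=
  Finset.sum_congr rfl fun π _ => prod_X_eq_monomial π

-- adapted from Theorems/DivisionGapPerMultiplesHardStubRichFaces.lean
-- (`support_sum_monomial_permMonomial`)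
/-- The support of `Σ_{π ∈ S} Π_i X_{π i, i}` is `μ(S)` (`μ` is injective, all coefficients
are `1`). [folklore] -/
theorem support_sum_prod_X (S : Finset (Equiv.Perm (Fin n))) :
    (∑ π ∈ S, ∏ i : Fin n, (X (π i, i) : MvPolynomial (Fin n × Fin n) ℝ≥0)).support =
      S.image permMonomial := by
  classical
  rw [sum_prod_X_eq]
  ext d
  rw [mem_support_iff, coeff_sum, Finset.mem_image]
  simp only [coeff_monomial]
  constructor
  · intro h
    obtain ⟨σ, hσ, hne⟩ := Finset.exists_ne_zero_of_sum_ne_zero h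
    refine ⟨σ, hσ, ?_⟩
    by_contra hd
    exact hne (if_neg hd)
  · rintro ⟨σ, hσ, rfl⟩
    rw [Finset.sum_eq_single σ]
    · simp
    · intro τ _ hτ
      exact if_neg (permMonomial_injective.ne hτ)
    · intro h
      exact absurd hσ h

/-- Membership in the support of `Σ_{π ∈ S} Π_i X_{π i, i}`. [folklore] -/
theorem mem_support_sum_prod_X {S : Finset (Equiv.Perm (Fin n))} {m : Fin n × Fin n →₀ ℕ} :
    m ∈ (∑ π ∈ S, ∏ i : Fin n, (X (π i, i) : MvPolynomial (Fin n × Fin n) ℝ≥0)).support ↔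
      ∃ π ∈ S, permMonomial π = m := by
  rw [support_sum_prod_X, Finset.mem_image]

/-- The support of `Σ_{π ∈ S} Π_i X_{π i, i}` lies in the support of the permanent. [folklore] -/
theorem support_sum_prod_X_subset (S : Finset (Equiv.Perm (Fin n))) :
    (∑ π ∈ S, ∏ i : Fin n, (X (π i, i) : MvPolynomial (Fin n × Fin n) ℝ≥0)).support ⊆
      (perPoly (Fin n) ℝ≥0).support := by
  intro m hm
  obtain ⟨π, -, rfl⟩ := mem_support_sum_prod_X.1 hm
  exact (mem_support_perPoly ℝ≥0).2 ⟨π, rfl⟩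

/-- `|supp (Σ_{π ∈ S} Π_i X_{π i, i})| = |S|`. [folklore] -/
theorem card_support_sum_prod_X (S : Finset (Equiv.Perm (Fin n))) :
    (∑ π ∈ S, ∏ i : Fin n, (X (π i, i) : MvPolynomial (Fin n × Fin n) ℝ≥0)).support.card =
      S.card := by
  rw [support_sum_prod_X, Finset.card_image_of_injective _ permMonomial_injective]

/-! ### Torus types of permutation monomials -/

/-- The row margins of a permutation monomial are all `1`. [folklore] -/
theorem mapDomain_fst_permMonomial (π : Equiv.Perm (Fin n)) :
    Finsupp.mapDomain Prod.fst (permMonomial π) = ∑ i : Fin n, Finsupp.single i 1 := by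
  rw [permMonomial, Finsupp.mapDomain_finsetSum]
  simp_rw [Finsupp.mapDomain_single]
  exact Equiv.sum_comp π (fun i => Finsupp.single i 1)

/-- The column margins of a permutation monomial are all `1`. [folklore] -/
theorem mapDomain_snd_permMonomial (π : Equiv.Perm (Fin n)) :
    Finsupp.mapDomain Prod.snd (permMonomial π) = ∑ i : Fin n, Finsupp.single i 1 := by
  rw [permMonomial, Finsupp.mapDomain_finsetSum]
  simp_rw [Finsupp.mapDomain_single]

/-- The all-ones margin vector has total `n`. [folklore] -/
theorem degree_sum_single_one : (∑ i : Fin n, Finsupp.single i 1 : Fin n →₀ ℕ).degree = n := by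
  rw [map_sum]
  simp

/-! ### Arithmetic of Jerrum–Snir's weights: `w` is monotone and `w(d) · δ(r, d) ≤ n²` -/

/-- `w` is monotone: `w(d) ≤ w(d')` for `d ≤ d'` (each term of the sum (3.6) is positive).
[cite: JerrumSnir1982, (3.6)] -/
theorem perWeight_mono {d d' : ℕ} (h : d ≤ d') : perWeight n d ≤ perWeight n d' := by
  unfold perWeight
  apply Finset.sum_le_sum_of_subset_of_nonneg (Finset.range_subset_range.2 (by omega))
  intro i _ _
  positivity

/-- `w(d) · d! · (n-d)! ≤ d²` for `1 ≤ d`, `2d ≤ n + 1`: by induction on `d` with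
`w(d+1) = w(d) + 1/(d! (n-d-1)!)` (`perWeight_succ`) and `(d+1)! (n-d-1)! ≤ d! (n-d)!` for
`d + 1 ≤ n - d`. [folklore] -/
theorem perWeight_mul_factorial_le_sq :
    ∀ d : ℕ, 1 ≤ d → 2 * d ≤ n + 1 →
      perWeight n d * ((d.factorial * (n - d).factorial : ℕ) : ℝ) ≤ (d : ℝ) ^ 2 := by
  intro d hd
  induction d, hd using Nat.le_induction with
  | base =>
    intro _
    rw [perWeight_one, zero_mul]
    positivity
  | succ d hd ih =>
    intro h2
    have ih' := ih (by omega)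
    have hle : ((d + 1 : ℕ) : ℝ) ≤ ((n - d : ℕ) : ℝ) := by
      exact_mod_cast (show d + 1 ≤ n - d by omega)
    rw [perWeight_succ n hd]
    set F : ℝ := ((d.factorial * (n - (d + 1)).factorial : ℕ) : ℝ) with hF
    have hFpos : 0 < F := by rw [hF]; positivity
    have e1 : (((d + 1).factorial * (n - (d + 1)).factorial : ℕ) : ℝ) = (d + 1) * F := by
      rw [hF]; push_cast [Nat.factorial_succ]; ring
    have e2 : ((d.factorial * (n - d).factorial : ℕ) : ℝ) = ((n - d : ℕ) : ℝ) * F := by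
      rw [hF, show n - d = n - (d + 1) + 1 by omega, Nat.factorial_succ]; push_cast; ring
    rw [e2] at ih'
    rw [e1]
    set W := perWeight n d with hW
    have hW0 : 0 ≤ W := perWeight_nonneg n d
    have hWF : 0 ≤ W * F := mul_nonneg hW0 hFpos.le
    have h3 : ((d + 1 : ℕ) : ℝ) * (W * F) ≤ ((n - d : ℕ) : ℝ) * (W * F) :=
      mul_le_mul_of_nonneg_right hle hWF
    have hd0 : (0 : ℝ) ≤ d := by positivity
    calc (W + 1 / F) * ((d + 1) * F) = ((d + 1 : ℕ) : ℝ) * (W * F) + (d + 1) := by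
          push_cast; field_simp
      _ ≤ ((n - d : ℕ) : ℝ) * (W * F) + (d + 1) := by linarith
      _ = W * (((n - d : ℕ) : ℝ) * F) + (d + 1) := by ring
      _ ≤ (d : ℝ) ^ 2 + (d + 1) := by linarith
      _ ≤ ((d + 1 : ℕ) : ℝ) ^ 2 := by push_cast; nlinarith

/-- `(r-d)! (n-r)! ≤ (n-d)!` for `d ≤ r ≤ n` (as `C(n-d, r-d) ≥ 1`). [folklore] -/
theorem factorial_sub_mul_factorial_sub_le {d r : ℕ} (hdr : d ≤ r) (hrn : r ≤ n) :
    (r - d).factorial * (n - r).factorial ≤ (n - d).factorial := by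
  have h := Nat.choose_mul_factorial_mul_factorial (show r - d ≤ n - d by omega)
  rw [show n - d - (r - d) = n - r by omega] at h
  calc (r - d).factorial * (n - r).factorial
      ≤ (n - d).choose (r - d) * ((r - d).factorial * (n - r).factorial) :=
        Nat.le_mul_of_pos_left _ (Nat.choose_pos (by omega))
    _ = (n - d).factorial := by rw [← mul_assoc]; exact h

/-- **`w(d) · δ(r, d) ≤ n²`** for `1 ≤ d`, `2d ≤ r ≤ n` (`δ(r,d) = d!(r-d)!(n-r)! ≤ d!(n-d)!` and
`w(d) d! (n-d)! ≤ d² ≤ n²`). [folklore] -/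
theorem perWeight_mul_perDelta_le {d r : ℕ} (hd : 1 ≤ d) (h2 : 2 * d ≤ r) (hrn : r ≤ n) :
    perWeight n d * perDelta n r d ≤ (n : ℝ) ^ 2 := by
  have hδ : perDelta n r d ≤ ((d.factorial * (n - d).factorial : ℕ) : ℝ) := by
    unfold perDelta
    rw [mul_assoc]
    exact_mod_cast Nat.mul_le_mul_left _ (factorial_sub_mul_factorial_sub_le (by omega) hrn)
  have hdn : (d : ℝ) ^ 2 ≤ (n : ℝ) ^ 2 := by
    have : (d : ℝ) ≤ n := by exact_mod_cast (show d ≤ n by omega)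
    nlinarith
  calc perWeight n d * perDelta n r d
      ≤ perWeight n d * ((d.factorial * (n - d).factorial : ℕ) : ℝ) :=
        mul_le_mul_of_nonneg_left hδ (perWeight_nonneg n d)
    _ ≤ (d : ℝ) ^ 2 := perWeight_mul_factorial_le_sq d hd (by omega)
    _ ≤ (n : ℝ) ^ 2 := hdn

/-- **The jump constraint, arithmetic core.** For `d_a + d_b ≤ n` and
`0 ≤ S ≤ d_a! d_b! (n-d_a-d_b)!`,
`((w(d_a+d_b) - max(w d_a, w d_b)) / (n²+1)) · S ≤ 1`: WLOG `d_a ≤ d_b`, so the `max` is `w(d_b)`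
(monotonicity); if `d_a = 0` the factor vanishes, else `w(d_a+d_b) - w(d_b) ≤ w(d_a) + 1/δ` by the
recurrence `perWeight_rec` with `δ = δ(d_a+d_b, d_a) ≥ S`, and `(w(d_a) + 1/δ) · δ ≤ n² + 1`.
[cite: JerrumSnir1982, Thm. 3.4 and §4.3] -/
theorem jump_core {da db : ℕ} (h : da + db ≤ n) {S : ℝ} (hS0 : 0 ≤ S)
    (hS : S ≤ ((da.factorial * db.factorial * (n - (da + db)).factorial : ℕ) : ℝ)) :
    (perWeight n (da + db) / ((n : ℝ) ^ 2 + 1) -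
        max (perWeight n da / ((n : ℝ) ^ 2 + 1)) (perWeight n db / ((n : ℝ) ^ 2 + 1))) * S ≤ 1 := by
  wlog hle : da ≤ db generalizing da db
  · have hS' : S ≤ ((db.factorial * da.factorial * (n - (db + da)).factorial : ℕ) : ℝ) := by
      rw [mul_comm (db.factorial), add_comm db da]; exact hS
    have := this (by omega) hS' (by omega)
    rwa [add_comm db da, max_comm] at this
  have hKpos : (0 : ℝ) < (n : ℝ) ^ 2 + 1 := by positivity
  set K : ℝ := (n : ℝ) ^ 2 + 1 with hK
  rw [max_div_div_right hKpos.le, ← sub_div, max_eq_right (perWeight_mono hle)]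
  rcases Nat.eq_zero_or_pos da with rfl | hd
  · simp
  have hrec := perWeight_rec (n := n) (r := da + db) hd (by omega) h
  rw [Nat.add_sub_cancel_left] at hrec
  set δ : ℝ := perDelta n (da + db) da with hδdef
  have hδ : δ = ((da.factorial * db.factorial * (n - (da + db)).factorial : ℕ) : ℝ) := by
    rw [hδdef]; unfold perDelta; rw [Nat.add_sub_cancel_left]
  have hδpos : 0 < δ := perDelta_pos n (da + db) da
  have hSδ : S ≤ δ := by rw [hδ]; exact hS
  have hwd : perWeight n da * δ ≤ (n : ℝ) ^ 2 :=
    perWeight_mul_perDelta_le hd (by omega) h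
  have hrec' : perWeight n (da + db) - perWeight n db ≤ perWeight n da + 1 / δ := by linarith
  have hnonneg : 0 ≤ (perWeight n da + 1 / δ) / K :=
    div_nonneg (add_nonneg (perWeight_nonneg n da) (by positivity)) hKpos.le
  calc (perWeight n (da + db) - perWeight n db) / K * S ≤ (perWeight n da + 1 / δ) / K * S :=
        mul_le_mul_of_nonneg_right (div_le_div_of_nonneg_right hrec' hKpos.le) hS0
    _ ≤ (perWeight n da + 1 / δ) / K * δ := mul_le_mul_of_nonneg_left hSδ hnonneg
    _ = (perWeight n da * δ + 1) / K := by field_simp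
    _ ≤ 1 := by rw [div_le_one hKpos, hK]; linarith

/-! ### The certificate for an arbitrary set of permutations -/

/-- **Jerrum–Snir's weights as a path certificate for `Σ_{π ∈ S} Π_i X_{π i, i}`.** For every finite
set `S` of permutations of `Fin n`, the triple `τg = (𝟙, 𝟙)`, `p ≡ 1`, `φ(τ) = w(|τ.1|)/(n²+1)` is a
path certificate (single type, `p ≥ 0`, `φ` vanishes on leaves, jump constraint) of value
`= |S| · n (2^{n-1} - 1) / ((n²+1) · n!)`. [cite: JerrumSnir1982, §4.3] -/
theorem faceCertificate (n : ℕ) (S : Finset (Equiv.Perm (Fin n))) :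
    ∃ (τg : (Fin n →₀ ℕ) × (Fin n →₀ ℕ)) (p : ((Fin n × Fin n) →₀ ℕ) → ℝ)
        (φ : (Fin n →₀ ℕ) × (Fin n →₀ ℕ) → ℝ),
        (∀ m ∈ (∑ π ∈ S,
            ∏ i : Fin n, (MvPolynomial.X (π i, i) : MvPolynomial (Fin n × Fin n) NNReal)).support,
          (Finsupp.mapDomain Prod.fst m, Finsupp.mapDomain Prod.snd m) = τg) ∧
        (∀ m, 0 ≤ p m) ∧ φ 0 ≤ 0 ∧
        (∀ e : Fin n × Fin n, φ (Finsupp.single e.1 1, Finsupp.single e.2 1) ≤ 0) ∧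
        (∀ (A B C : Finset ((Fin n × Fin n) →₀ ℕ)) (τ₁ τ₂ : (Fin n →₀ ℕ) × (Fin n →₀ ℕ)),
          (∀ a ∈ A, (Finsupp.mapDomain Prod.fst a, Finsupp.mapDomain Prod.snd a) = τ₁) →
          (∀ b ∈ B, (Finsupp.mapDomain Prod.fst b, Finsupp.mapDomain Prod.snd b) = τ₂) →
          (∀ a ∈ A, ∀ b ∈ B, ∀ c ∈ C, a + b + c ∈
            (∑ π ∈ S,
              ∏ i : Fin n,
                (MvPolynomial.X (π i, i) : MvPolynomial (Fin n × Fin n) NNReal)).support) →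
          (φ (τ₁ + τ₂) - max (φ τ₁) (φ τ₂)) * (∑ a ∈ A, ∑ b ∈ B, ∑ c ∈ C, p (a + b + c)) ≤ 1) ∧
        ((S.card : ℕ) : ℝ) * ((n : ℝ) * ((2 : ℝ) ^ (n - 1) - 1)) ≤
          (((n : ℝ) ^ 2 + 1) * (n.factorial : ℝ)) *
            ((∑ m ∈ (∑ π ∈ S,
                ∏ i : Fin n,
                  (MvPolynomial.X (π i, i) : MvPolynomial (Fin n × Fin n) NNReal)).support, p m) *
              φ τg) := by
  classical
  refine ⟨(∑ i : Fin n, Finsupp.single i 1, ∑ i : Fin n, Finsupp.single i 1), fun _ => 1,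
    fun τ => perWeight n τ.1.degree / ((n : ℝ) ^ 2 + 1), ?_, ?_, ?_, ?_, ?_, ?_⟩
  · -- every monomial is a permutation monomial, of type `(𝟙, 𝟙)`
    intro m hm
    obtain ⟨π, -, rfl⟩ := mem_support_sum_prod_X.1 hm
    rw [mapDomain_fst_permMonomial, mapDomain_snd_permMonomial]
  · intro _
    exact zero_le_one
  · simp
  · intro e
    simp
  · -- the jump constraint
    intro A B C τ₁ τ₂ hA hB hABC
    simp only [Finset.sum_const, nsmul_eq_mul, mul_one]
    rcases A.eq_empty_or_nonempty with rfl | ⟨a, ha⟩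
    · simp
    rcases B.eq_empty_or_nonempty with rfl | ⟨b, hb⟩
    · simp
    rcases C.eq_empty_or_nonempty with rfl | hC
    · simp
    have hper : ∀ a' ∈ A, ∀ b' ∈ B, ∀ c' ∈ C, a' + b' + c' ∈ (perPoly (Fin n) ℝ≥0).support :=
      fun a' ha' b' hb' c' hc' => support_sum_prod_X_subset S (hABC a' ha' b' hb' c' hc')
    obtain ⟨hcard, hdeg⟩ := card_mul_card_mul_card_le ℝ≥0 ha hb hC hper
    obtain rfl := hA a ha
    obtain rfl := hB b hb
    simp only [Prod.fst_add, map_add, Finsupp.degree_mapDomain]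
    rw [map_add] at hdeg hcard
    refine jump_core hdeg (by positivity) ?_
    rw [← mul_assoc]
    exact_mod_cast hcard
  · -- the value
    simp only [Finset.sum_const, nsmul_eq_mul, mul_one, card_support_sum_prod_X,
      degree_sum_single_one]
    rcases Nat.eq_zero_or_pos n with rfl | hn
    · simp
    · have hfw := factorial_mul_perWeight hn
      refine le_of_eq ?_
      calc ((S.card : ℕ) : ℝ) * ((n : ℝ) * ((2 : ℝ) ^ (n - 1) - 1))
            = (S.card : ℝ) * ((n.factorial : ℝ) * perWeight n n) := by rw [hfw]
        _ = ((n : ℝ) ^ 2 + 1) * (n.factorial : ℝ) *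
              ((S.card : ℝ) * (perWeight n n / ((n : ℝ) ^ 2 + 1))) := by
            field_simp

/-! ### The stub -/

/-- **S4 `stub_faceCertificate`** (Jerrum–Snir's permanent weights are path-feasible up to
`n² + 1`).
For every bipartite graph `G ⊆ [n]×[n]` the face permanent `per(G) = Σ_{π ⊆ G} x^{P_π}` carries a
path certificate of value `≥ |PM(G)| · n(2^{n-1}-1) / ((n²+1) · n!)`: `p ≡ 1` on `PM(G)`,
`φ(τ) = w_JS(|τ|)/(n²+1)` with the tree's `JerrumSnir.perWeight` (`n! · w_JS(n) = n(2^{n-1}-1)`,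
`factorial_mul_perWeight`); the path constraint follows from the tree's recurrence `perWeight_rec`,
monotonicity of `w_JS` and `w(d) · δ(r,d) ≤ n²`; the content bound for `PM(G) ⊆ B_n` is the
permanent's (`card_mul_card_mul_card_le` in `MonotoneGapPermanentLower.lean`) — the case
`S = PM(G)` of `faceCertificate`. [cite: JerrumSnir1982, §4.3] -/
theorem stub_faceCertificate :
    ∀ (n : ℕ) (G : Finset (Fin n × Fin n)),
      ∃ (τg : (Fin n →₀ ℕ) × (Fin n →₀ ℕ)) (p : ((Fin n × Fin n) →₀ ℕ) → ℝ)
        (φ : (Fin n →₀ ℕ) × (Fin n →₀ ℕ) → ℝ),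
        (∀ m ∈ (∑ π ∈ (Finset.univ : Finset (Equiv.Perm (Fin n))).filter (fun π => ∀ i : Fin n, (π i, i) ∈ G),
            ∏ i : Fin n, (MvPolynomial.X (π i, i) : MvPolynomial (Fin n × Fin n) NNReal)).support,
          (Finsupp.mapDomain Prod.fst m, Finsupp.mapDomain Prod.snd m) = τg) ∧
        (∀ m, 0 ≤ p m) ∧ φ 0 ≤ 0 ∧
        (∀ e : Fin n × Fin n, φ (Finsupp.single e.1 1, Finsupp.single e.2 1) ≤ 0) ∧
        (∀ (A B C : Finset ((Fin n × Fin n) →₀ ℕ)) (τ₁ τ₂ : (Fin n →₀ ℕ) × (Fin n →₀ ℕ)),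
          (∀ a ∈ A, (Finsupp.mapDomain Prod.fst a, Finsupp.mapDomain Prod.snd a) = τ₁) →
          (∀ b ∈ B, (Finsupp.mapDomain Prod.fst b, Finsupp.mapDomain Prod.snd b) = τ₂) →
          (∀ a ∈ A, ∀ b ∈ B, ∀ c ∈ C, a + b + c ∈
            (∑ π ∈ (Finset.univ : Finset (Equiv.Perm (Fin n))).filter (fun π => ∀ i : Fin n, (π i, i) ∈ G),
              ∏ i : Fin n, (MvPolynomial.X (π i, i) : MvPolynomial (Fin n × Fin n) NNReal)).support) →
          (φ (τ₁ + τ₂) - max (φ τ₁) (φ τ₂)) * (∑ a ∈ A, ∑ b ∈ B, ∑ c ∈ C, p (a + b + c)) ≤ 1) ∧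
        ((((Finset.univ : Finset (Equiv.Perm (Fin n))).filter (fun π => ∀ i : Fin n, (π i, i) ∈ G)).card : ℕ) : ℝ) *
            ((n : ℝ) * ((2 : ℝ) ^ (n - 1) - 1)) ≤
          (((n : ℝ) ^ 2 + 1) * (n.factorial : ℝ)) *
            ((∑ m ∈ (∑ π ∈ (Finset.univ : Finset (Equiv.Perm (Fin n))).filter (fun π => ∀ i : Fin n, (π i, i) ∈ G),
                ∏ i : Fin n, (MvPolynomial.X (π i, i) : MvPolynomial (Fin n × Fin n) NNReal)).support, p m) *
              φ τg) :=
  fun n _ => faceCertificate n _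

end Summit.ValiantsHypothesis.ValiantsHypothesis.Theorems.DivisionGap.PerMultiplesHard.FaceCertificate

end
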